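import Summits.ABC.IUTFork.Thm311Checks
import Mathlib.LinearAlgebra.PiTensorProduct.Basis
import Mathlib.LinearAlgebra.StdBasis
import HarnessLib

/-!
# Fork skeleton SCHEMA row F-2283 `LatticeSituation.LogvolIndInvariant` — ∀-closure REFUTED (instance of record: `toy_logvolIndInvariant`)

PROOF-ONLY companion (0 `def`, 0 `instance`, 0 notation; the witness situation is built inside the theorem term) of the
abc-iut cell, block F (seat abc-iut-f-130, gen 7; director-abc g4 ROW SUPPLY `ROWS-LF-0348.tsv` «decide the label»), sequel to
`ForkSkeletonSchemaClosures{,B,C,D}.lean`. It imports — never edits — abc-iut-c312-1's `Thm311Pilot` (the decl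
`Thm311.LatticeSituation.LogvolIndInvariant`: "every indeterminacy of the group generated by (Ind1), (Ind2) maps admissible
regions to admissible regions OF THE SAME mono-analytic log-volume … a property an INSTANTIATION proves … NOT assumed by
Theorem 3.11 as typed") and c312-1's toy of record `Thm311Checks` (`toyIndex`, `toyShells`; INSTANCE of record:
`Thm311.toy_logvolIndInvariant`, all log-volumes `0`).

`not_forall_logvolIndInvariant` — the universal closure is FALSE: over the toy index take log-shells `ℚ` whose `Ism` is ALL of
`GL₁(ℚ)` (the signature leaves `Ism` free), the (Ind2)-family acting by `2` on every summand of every factor (an element of the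
generated group `IndGroup`), everything admissible, and the log-volume `A ↦ 𝟙[x₀ ∈ A]` for the basis tensor `x₀ = ⊗_i e` of the
packet at label `1`; the family carries `{x₀}` to `{4·x₀} ∌ x₀` (`x₀ ≠ 0`), so the log-volume drops from `1` to `0`. This is the
kernel form of the docstring's own remark that log-volume invariance of (Ind1), (Ind2) comes from the INSTANTIATION (isometries,
permutations of tensor factors — Dupuy–Hilado §4.7–4.10; the cell's Haar/`p`-adic models), not from the signature.

HONEST FRAMING: a refuted ∀-closure says only that the SCHEMA over the free c312-1 signature is not a theorem at junk data; nothing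
here bears on [IUTchIII] Thm. 3.11 / Cor. 3.12 or [IUTchIV] Thm. 1.10 Step (v), and no side is taken on any author. A FACT row is
an assumption label on OUR typed statement; typed ≠ proved. [claim: Mochizuki2012, status: disputed] [cite: DupuyHilado2025, §4.7–4.10]
-/

noncomputable section

namespace Summit.ABC

namespace IUTFork

namespace SchemaClosures

open Thm311 PiTensorProduct Module

/-- **F-2283, ∀-closure REFUTED**: there are a lattice situation over c312-1's toy index (log-shells `ℚ` with `Ism = GL₁(ℚ)`,
log-volume the indicator of a basis tensor `x₀`, everything admissible), an element of `IndGroup` (the (Ind2)-family "multiply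
every summand of every factor by `2`") and an admissible region (`{x₀}`) whose image has a DIFFERENT log-volume. Instance of record
(where the schema holds): `Thm311.toy_logvolIndInvariant`; conditional form: `logvolIndInvariant_of_logvolInvariant`.
[claim: Mochizuki2012, status: disputed] -/
theorem not_forall_logvolIndInvariant :
    ¬ ∀ (T : ThetaIndex) (S : LatticeSituation T) (n : ℤ) (j : T.LabelStar) (vQ : T.VQ),
        S.LogvolIndInvariant n j vQ := by
  classical
  intro h
  -- log-shells `ℚ` over the toy index with Ism = all linear automorphisms
  let L : LogShells toyIndex :=
    { toyShells with ism := fun _ => Set.univ, one_mem_ism := fun _ => Set.mem_univ _ }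
  -- the basis tensor `x₀(j, v_ℚ) = ⊗_{i ∈ S^±_{j+1}} e_{v}` of every packet (`#fibre = 1` in the toy)
  let pt : ∀ vQ : toyIndex.VQ, toyIndex.Fibre vQ := fun vQ => ⟨vQ, rfl⟩
  let bas : ∀ (j : toyIndex.Label) (vQ : toyIndex.VQ),
      Basis (toyIndex.Caps j → toyIndex.Fibre vQ) ℚ (L.Packet j vQ) :=
    fun j vQ => Basis.piTensorProduct fun _ : toyIndex.Caps j => Pi.basisFun ℚ (toyIndex.Fibre vQ)
  let x₀ : ∀ (j : toyIndex.Label) (vQ : toyIndex.VQ), L.Packet j vQ := fun j vQ => bas j vQ fun _ => pt vQ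
  have hx₀ : ∀ j vQ, x₀ j vQ ≠ 0 := fun j vQ => (bas j vQ).ne_zero _
  have hx₀_eq : ∀ j vQ, x₀ j vQ = tprod ℚ fun _ : toyIndex.Caps j => Pi.basisFun ℚ (toyIndex.Fibre vQ) (pt vQ) :=
    fun j vQ => Basis.piTensorProduct_apply _ _
  -- data: everything admissible, log-volume = indicator of x₀
  let D : MRData L :=
    { shellPk := fun _ _ => ∅, shellSub := fun _ _ => ∅, Adm := fun _ _ _ => True,
      logvol := fun j vQ A => if x₀ j vQ ∈ A then 1 else 0, Ψ := fun _ _ => ∅, act := fun _ _ _ => 0, Mmod := fun _ => ∅ }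
  let G : ∀ j : toyIndex.LabelStar, GlobalDegrees L j := fun _ =>
    { ObjMOD := Unit, Objmod := Unit, natIso := Equiv.refl Unit, deg := fun _ => 0, region := fun _ _ => ∅ }
  let C : Column L :=
    { frobAdm := fun _ _ _ _ => True, frobLogvol := fun _ _ _ _ => 0, frobΨ := fun _ _ _ => ∅, frobMmod := fun _ _ => ∅,
      unitImage := fun _ _ _ _ => ∅, ballImage := fun _ _ _ => ∅, ObjLGP := Unit, frobObjLGP := fun _ => Unit,
      kumLGP := fun _ => Equiv.refl Unit, ObjLgp := Unit, frobObjLgp := fun _ => Unit, kumLgp := fun _ => Equiv.refl Unit,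
      thetaPilot := fun _ => () }
  let S : LatticeSituation toyIndex := { L := L, D := fun _ => D, G := fun _ => G, col := fun _ => C }
  -- the (Ind2)-family: multiply every summand of every factor by 2
  let two : ℚ ≃ₗ[ℚ] ℚ := LinearEquiv.smulOfNeZero ℚ ℚ 2 two_ne_zero
  let Φ : L.PacketAut := fun j vQ => L.factorwise j vQ fun _ => L.summandwise vQ fun _ => two
  have hΦ : Φ ∈ L.IndGroup :=
    L.ind2Family_subset_indGroup fun j vQ => ⟨fun _ _ => two, fun _ _ => Set.mem_univ _, rfl⟩
  -- its effect on x₀: multiplication by 2^(j+1)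
  have hΦx : ∀ (j : toyIndex.Label) (vQ : toyIndex.VQ),
      Φ j vQ (x₀ j vQ) = ((2 : ℚ) ^ Fintype.card (toyIndex.Caps j)) • x₀ j vQ := by
    intro j vQ
    rw [hx₀_eq]
    change PiTensorProduct.congr (fun _ => LinearEquiv.piCongrRight fun _ => two) (tprod ℚ _) = _
    rw [PiTensorProduct.congr_tprod]
    have : (fun i : toyIndex.Caps j => (LinearEquiv.piCongrRight fun _ : toyIndex.Fibre vQ => two)
        (Pi.basisFun ℚ (toyIndex.Fibre vQ) (pt vQ))) =
        fun i : toyIndex.Caps j => (2 : ℚ) • Pi.basisFun ℚ (toyIndex.Fibre vQ) (pt vQ) := by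
      funext i
      ext v
      simp [two, LinearEquiv.smulOfNeZero, LinearEquiv.smulOfUnit]
    rw [this, MultilinearMap.map_smul_univ, Finset.prod_const, Finset.card_univ]
    rfl
  -- apply the schema at label 1 to the region {x₀}
  let j : toyIndex.LabelStar := ⟨1, by decide⟩
  obtain ⟨-, hvol⟩ := h toyIndex S 0 j () Φ hΦ {x₀ j.1 ()} trivial
  change (if x₀ j.1 () ∈ Φ j.1 () '' {x₀ j.1 ()} then (1 : ℝ) else 0) =
    (if x₀ j.1 () ∈ ({x₀ j.1 ()} : Set (L.Packet j.1 ())) then (1 : ℝ) else 0) at hvol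
  rw [if_pos (Set.mem_singleton _), Set.image_singleton, hΦx] at hvol
  -- so x₀ = 2^2 • x₀, i.e. x₀ = 0: contradiction
  have hmem : x₀ j.1 () ∈ ({((2 : ℚ) ^ Fintype.card (toyIndex.Caps j.1)) • x₀ j.1 ()} : Set (L.Packet j.1 ())) := by
    by_contra hn
    rw [if_neg hn] at hvol
    norm_num at hvol
  rw [Set.mem_singleton_iff] at hmem
  have hcard : Fintype.card (toyIndex.Caps j.1) = 2 := by simp [ThetaIndex.Caps, j, toyIndex]
  rw [hcard] at hmem
  have h3 : ((2 : ℚ) ^ 2 - 1) • x₀ j.1 () = 0 := by rw [sub_smul, one_smul, ← hmem, sub_self]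
  rw [smul_eq_zero] at h3
  rcases h3 with h3 | h3
  · norm_num at h3
  · exact hx₀ _ _ h3

end SchemaClosures

end IUTFork

end Summit.ABC

end
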